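import Mathlib.Data.Nat.Choose.Basic
import Mathlib.Algebra.BigOperators.Intervals
import Mathlib.Algebra.Order.BigOperators.Group.Finset
import Mathlib.Tactic
import HarnessLib

/-!
# Two-level monotonicity of the conditional block magnetisation (CONJECTURE U, kernel route)

Support file for the Sahi / Conjecture-P programme of route `PercNearOneGluingNoHeavy`
(`--supports stmt-CriticalPhenomena-4575`, prover prim-l12-p5 gen 28; proof note
`prim-l12-p5/U-STRUCTURE-g28.md` §2–3).  No definitions, no named facts, no sorries.

Setting (note §2).  A BLOCK `(M, L, w)` has `M` fair coins of the first kind with weight `w(x)` on their head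
count `x` and `L` fair buffer coins; with the guarded buffer factor `G(L,k,x) = C(L,k-x)` (`0` if `x > k`) its
block sums are `F(k) = ∑_x C(M,x) G(L,k,x) w(x)` and `Mo(k) = ∑_x C(M,x) G(L,k,x) w(x) (2x-M)` (tree:
`CoreBlock`).  CONJECTURE U at an off-centre section with shift `j` involves the TWO-LEVEL sums
`F(b) + F(b+j)` and `Mo(b) + Mo(b+j)`, whose ratio is the conditional mean of `2x - M` under the kernel
`G(L,b,x) + G(L,b+j,x) = Φ_j(b+j-x)` with the 'two-bump' sequence `Φ_j(t) = C(L,t) + C(L,t-j)`.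
This file proves:

* `two_mul_mlr_gap`, `mlr_step` : the generic one-step MLR (TP₂) monotonicity of a kernel average of a
  nondecreasing function — an antisymmetrisation argument, no probability;
* `guard_tp2` : a guarded difference kernel `(b,x) ↦ Φ(b-x)` is one-step TP₂ when `Φ ≥ 0` satisfies the
  two-point log-concavity inequality `Φ(m)Φ(m'+1) ≤ Φ(m+1)Φ(m')` (`m ≤ m'`);
* `two_level_kernel` : `G(L,b,x) + G(L,b+j,x)` is such a kernel with `Φ = Φ_j`;
* `tlm_of_lc2` : hence, for ANY nonnegative weights `a(x)`, the two-level ratio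
  `(∑ a(x)(2x-M)[G(L,b,x)+G(L,b+j,x)]) / (∑ a(x)[G(L,b,x)+G(L,b+j,x)])` is nondecreasing in `b`
  (cross-multiplied form) whenever `Φ_j` is two-point log-concave — THEOREM U-LC's engine (note §3);
* `choose_lc2`, `phi_lc2_zero`, `phi_lc2_one` : the two-point log-concavity of `C(n,·)`, and of `Φ_j` for
  `j = 0, 1` (for general `j` it holds iff `j² ≤ L+3`, note §2; not proved here).
-/

namespace Summit.CriticalPhenomena.PercolationContinuityZ3.Theorems

namespace TwoLevel

open Finset

/-! ### Generic one-step MLR monotonicity -/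

/-- Antisymmetrisation identity: for weights `a`, a function `d` and two kernels `κ₀, κ₁`,
`2·[(∑ a d κ₁)(∑ a κ₀) − (∑ a d κ₀)(∑ a κ₁)] = ∑_i ∑_j a_i a_j (d_i − d_j)(κ₁ᵢ κ₀ⱼ − κ₀ᵢ κ₁ⱼ)`. -/
theorem two_mul_mlr_gap (s : Finset ℕ) (a d κ₀ κ₁ : ℕ → ℝ) :
    2 * ((∑ i ∈ s, a i * d i * κ₁ i) * (∑ i ∈ s, a i * κ₀ i) -
        (∑ i ∈ s, a i * d i * κ₀ i) * (∑ i ∈ s, a i * κ₁ i)) =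
      ∑ i ∈ s, ∑ j ∈ s, a i * a j * ((d i - d j) * (κ₁ i * κ₀ j - κ₀ i * κ₁ j)) := by
  have h1 : (∑ i ∈ s, a i * d i * κ₁ i) * (∑ i ∈ s, a i * κ₀ i) =
      ∑ i ∈ s, ∑ j ∈ s, a i * d i * κ₁ i * (a j * κ₀ j) := by rw [sum_mul_sum]
  have h2 : (∑ i ∈ s, a i * d i * κ₀ i) * (∑ i ∈ s, a i * κ₁ i) =
      ∑ i ∈ s, ∑ j ∈ s, a i * d i * κ₀ i * (a j * κ₁ j) := by rw [sum_mul_sum]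
  have h3 : (∑ i ∈ s, a i * κ₁ i) * (∑ i ∈ s, a i * d i * κ₀ i) =
      ∑ i ∈ s, ∑ j ∈ s, a i * κ₁ i * (a j * d j * κ₀ j) := by rw [sum_mul_sum]
  have h4 : (∑ i ∈ s, a i * κ₀ i) * (∑ i ∈ s, a i * d i * κ₁ i) =
      ∑ i ∈ s, ∑ j ∈ s, a i * κ₀ i * (a j * d j * κ₁ j) := by rw [sum_mul_sum]
  have key : ∑ i ∈ s, ∑ j ∈ s, a i * a j * ((d i - d j) * (κ₁ i * κ₀ j - κ₀ i * κ₁ j)) =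
      (∑ i ∈ s, ∑ j ∈ s, a i * d i * κ₁ i * (a j * κ₀ j))
        - (∑ i ∈ s, ∑ j ∈ s, a i * d i * κ₀ i * (a j * κ₁ j))
        - (∑ i ∈ s, ∑ j ∈ s, a i * κ₁ i * (a j * d j * κ₀ j))
        + (∑ i ∈ s, ∑ j ∈ s, a i * κ₀ i * (a j * d j * κ₁ j)) := by
    rw [← sum_sub_distrib, ← sum_sub_distrib, ← sum_add_distrib]
    refine sum_congr rfl fun i _ => ?_
    rw [← sum_sub_distrib, ← sum_sub_distrib, ← sum_add_distrib]
    refine sum_congr rfl fun j _ => ?_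
    ring
  rw [key, ← h1, ← h2, ← h3, ← h4]
  ring

/-- **One-step MLR monotonicity.**  If the weights `a` are nonnegative on `s`, `d` is nondecreasing on `s`,
and the kernels satisfy the one-step TP₂ inequality `κ₀ x · κ₁ y ≤ κ₁ x · κ₀ y` for `y < x` in `s`, then the
`κ`-average of `d` does not decrease from `κ₀` to `κ₁`, in cross-multiplied form:
`(∑ a d κ₀)(∑ a κ₁) ≤ (∑ a d κ₁)(∑ a κ₀)`. -/
theorem mlr_step (s : Finset ℕ) (a d κ₀ κ₁ : ℕ → ℝ) (ha : ∀ x ∈ s, 0 ≤ a x)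
    (hd : ∀ x ∈ s, ∀ y ∈ s, y ≤ x → d y ≤ d x)
    (htp : ∀ x ∈ s, ∀ y ∈ s, y < x → κ₀ x * κ₁ y ≤ κ₁ x * κ₀ y) :
    (∑ i ∈ s, a i * d i * κ₀ i) * (∑ i ∈ s, a i * κ₁ i) ≤
      (∑ i ∈ s, a i * d i * κ₁ i) * (∑ i ∈ s, a i * κ₀ i) := by
  have h := two_mul_mlr_gap s a d κ₀ κ₁
  have hnonneg : 0 ≤ ∑ i ∈ s, ∑ j ∈ s, a i * a j * ((d i - d j) * (κ₁ i * κ₀ j - κ₀ i * κ₁ j)) := by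
    refine sum_nonneg fun i hi => sum_nonneg fun j hj => ?_
    refine mul_nonneg (mul_nonneg (ha i hi) (ha j hj)) ?_
    rcases lt_trichotomy j i with hji | hji | hij
    · -- j < i : both factors ≥ 0
      have h1 : 0 ≤ d i - d j := sub_nonneg.mpr (hd i hi j hj hji.le)
      have h2 : 0 ≤ κ₁ i * κ₀ j - κ₀ i * κ₁ j := by
        have := htp i hi j hj hji
        linarith
      exact mul_nonneg h1 h2
    · subst hji
      simp
    · -- i < j : both factors ≤ 0
      have h1 : d i - d j ≤ 0 := sub_nonpos.mpr (hd j hj i hi hij.le)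
      have h2 : κ₁ i * κ₀ j - κ₀ i * κ₁ j ≤ 0 := by
        have := htp j hj i hi hij
        linarith
      exact mul_nonneg_of_nonpos_of_nonpos h1 h2
  linarith

/-! ### Guarded difference kernels -/

/-- A guarded difference kernel `κ_b(x) = Φ(b-x)` (`0` for `x > b`) built from a nonnegative `Φ` that is
two-point log-concave (`Φ(m)Φ(m'+1) ≤ Φ(m+1)Φ(m')` for `m ≤ m'`) is one-step TP₂:
`κ_b(x) κ_{b+1}(y) ≤ κ_{b+1}(x) κ_b(y)` for `y < x`. -/
theorem guard_tp2 (Φ : ℕ → ℝ) (hΦ : ∀ m, 0 ≤ Φ m)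
    (hlc : ∀ m m', m ≤ m' → Φ m * Φ (m' + 1) ≤ Φ (m + 1) * Φ m') (b x y : ℕ) (hyx : y < x) :
    (if x ≤ b then Φ (b - x) else 0) * (if y ≤ b + 1 then Φ (b + 1 - y) else 0) ≤
      (if x ≤ b + 1 then Φ (b + 1 - x) else 0) * (if y ≤ b then Φ (b - y) else 0) := by
  by_cases hxb : x ≤ b
  · -- all four guards hold
    have hyb : y ≤ b := by omega
    rw [if_pos hxb, if_pos (by omega), if_pos (by omega), if_pos hyb]
    have e1 : b + 1 - y = (b - y) + 1 := by omega
    have e2 : b + 1 - x = (b - x) + 1 := by omega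
    rw [e1, e2]
    exact hlc (b - x) (b - y) (by omega)
  · rw [if_neg hxb, zero_mul]
    refine mul_nonneg ?_ ?_
    · split_ifs
      · exact hΦ _
      · exact le_rfl
    · split_ifs
      · exact hΦ _
      · exact le_rfl

/-! ### The two-level kernel of a block -/

/-- The two-bump sequence `Φ_j(t) = C(L,t) + C(L,t-j)` (second term read as `0` for `t < j`). -/
theorem phi_nonneg (L j t : ℕ) :
    0 ≤ (L.choose t : ℝ) + (if j ≤ t then (L.choose (t - j) : ℝ) else 0) := by
  split_ifs <;> positivity

/-- **Two-level kernel identity.**  For the guarded buffer factor `G(L,k,x) = C(L,k-x)`: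
`G(L,b,x) + G(L,b+j,x) = Φ_j(b+j-x)` (guarded at `x ≤ b+j`), `Φ_j(t) = C(L,t) + C(L,t-j)`. -/
theorem two_level_kernel (L j b x : ℕ) :
    (if x ≤ b then (L.choose (b - x) : ℝ) else 0) + (if x ≤ b + j then (L.choose (b + j - x) : ℝ) else 0) =
      (if x ≤ b + j then
        ((L.choose (b + j - x) : ℝ) + (if j ≤ b + j - x then (L.choose (b + j - x - j) : ℝ) else 0))
        else 0) := by
  by_cases hxb : x ≤ b
  · rw [if_pos hxb, if_pos (by omega), if_pos (by omega), if_pos (by omega)]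
    have e : b + j - x - j = b - x := by omega
    rw [e]
    ring
  · rw [if_neg hxb, zero_add]
    by_cases hxbj : x ≤ b + j
    · rw [if_pos hxbj, if_pos hxbj, if_neg (by omega)]
      ring
    · rw [if_neg hxbj, if_neg hxbj]

/-- **Two-level monotonicity (engine of THEOREM U-LC, note §3).**  Let `a ≥ 0` be arbitrary weights on
`{0..M}` and suppose the two-bump sequence `Φ_j(t) = C(L,t) + C(L,t-j)` is two-point log-concave.  With the
two-level sums `E(b) = ∑_x a(x)[G(L,b,x)+G(L,b+j,x)]` and `D(b) = ∑_x a(x)(2x-M)[G(L,b,x)+G(L,b+j,x)]`,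
the ratio `D/E` is nondecreasing in `b`: `D(b)·E(b+1) ≤ D(b+1)·E(b)`. -/
theorem tlm_of_lc2 (M L j : ℕ) (a : ℕ → ℝ) (ha : ∀ x, 0 ≤ a x)
    (hlc : ∀ m m', m ≤ m' →
      ((L.choose m : ℝ) + (if j ≤ m then (L.choose (m - j) : ℝ) else 0)) *
        ((L.choose (m' + 1) : ℝ) + (if j ≤ m' + 1 then (L.choose (m' + 1 - j) : ℝ) else 0)) ≤
      ((L.choose (m + 1) : ℝ) + (if j ≤ m + 1 then (L.choose (m + 1 - j) : ℝ) else 0)) *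
        ((L.choose m' : ℝ) + (if j ≤ m' then (L.choose (m' - j) : ℝ) else 0)))
    (b : ℕ) :
    (∑ x ∈ range (M + 1), a x * (2 * (x : ℝ) - M) *
        ((if x ≤ b then (L.choose (b - x) : ℝ) else 0) +
          (if x ≤ b + j then (L.choose (b + j - x) : ℝ) else 0))) *
      (∑ x ∈ range (M + 1), a x *
        ((if x ≤ b + 1 then (L.choose (b + 1 - x) : ℝ) else 0) +
          (if x ≤ b + 1 + j then (L.choose (b + 1 + j - x) : ℝ) else 0))) ≤
    (∑ x ∈ range (M + 1), a x * (2 * (x : ℝ) - M) *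
        ((if x ≤ b + 1 then (L.choose (b + 1 - x) : ℝ) else 0) +
          (if x ≤ b + 1 + j then (L.choose (b + 1 + j - x) : ℝ) else 0))) *
      (∑ x ∈ range (M + 1), a x *
        ((if x ≤ b then (L.choose (b - x) : ℝ) else 0) +
          (if x ≤ b + j then (L.choose (b + j - x) : ℝ) else 0))) := by
  -- the two-bump sequence and the guarded kernels κ₀ = κ_{b+j}, κ₁ = κ_{b+j+1}
  set Φ : ℕ → ℝ := fun t => (L.choose t : ℝ) + (if j ≤ t then (L.choose (t - j) : ℝ) else 0) with hΦdef
  set κ₀ : ℕ → ℝ := fun x => if x ≤ b + j then Φ (b + j - x) else 0 with hκ₀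
  set κ₁ : ℕ → ℝ := fun x => if x ≤ b + j + 1 then Φ (b + j + 1 - x) else 0 with hκ₁
  have hk0 : ∀ x, (if x ≤ b then (L.choose (b - x) : ℝ) else 0) +
      (if x ≤ b + j then (L.choose (b + j - x) : ℝ) else 0) = κ₀ x := by
    intro x
    rw [two_level_kernel L j b x]
  have hk1 : ∀ x, (if x ≤ b + 1 then (L.choose (b + 1 - x) : ℝ) else 0) +
      (if x ≤ b + 1 + j then (L.choose (b + 1 + j - x) : ℝ) else 0) = κ₁ x := by
    intro x
    rw [two_level_kernel L j (b + 1) x]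
    have e : b + 1 + j = b + j + 1 := by ring
    simp only [hκ₁, hΦdef, e]
  simp_rw [hk0, hk1]
  have hΦpos : ∀ m, 0 ≤ Φ m := fun m => phi_nonneg L j m
  have hΦlc : ∀ m m', m ≤ m' → Φ m * Φ (m' + 1) ≤ Φ (m + 1) * Φ m' := by
    intro m m' hmm'
    have := hlc m m' hmm'
    simpa [hΦdef] using this
  refine mlr_step (range (M + 1)) a (fun x => 2 * (x : ℝ) - M) κ₀ κ₁ (fun x _ => ha x) ?_ ?_
  · intro x _ y _ hyx
    have : (y : ℝ) ≤ x := by exact_mod_cast hyx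
    linarith
  · intro x _ y _ hyx
    have h := guard_tp2 Φ hΦpos hΦlc (b + j) x y hyx
    simpa [hκ₀, hκ₁] using h

/-! ### Two-point log-concavity of binomial coefficients and of `Φ_0`, `Φ_1` -/

/-- Two-point log-concavity of `m ↦ C(n,m)`: `C(n,m)·C(n,m'+1) ≤ C(n,m+1)·C(n,m')` for `m ≤ m'`. -/
theorem choose_lc2 (n m m' : ℕ) (h : m ≤ m') :
    (n.choose m : ℝ) * (n.choose (m' + 1) : ℝ) ≤ (n.choose (m + 1) : ℝ) * (n.choose m' : ℝ) := by
  rcases le_or_gt n m' with hn | hn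
  · -- C(n, m'+1) = 0
    rw [Nat.choose_eq_zero_of_lt (show n < m' + 1 by omega)]
    simp only [Nat.cast_zero, mul_zero]
    positivity
  · -- m ≤ m' < n : use (k+1) C(n,k+1) = (n-k) C(n,k) twice
    have h1 := Nat.choose_succ_right_eq n m     -- C(n,m+1) * (m+1) = C(n,m) * (n-m)
    have h2 := Nat.choose_succ_right_eq n m'
    have c1 : ((n.choose (m + 1) * (m + 1) : ℕ) : ℝ) = ((n.choose m * (n - m) : ℕ) : ℝ) := by rw [h1]
    have c2 : ((n.choose (m' + 1) * (m' + 1) : ℕ) : ℝ) = ((n.choose m' * (n - m') : ℕ) : ℝ) := by rw [h2]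
    push_cast [Nat.cast_sub (show m ≤ n by omega), Nat.cast_sub hn.le] at c1 c2
    -- multiply the goal by (m+1)(m'+1) > 0
    have hm : (0 : ℝ) < (m : ℝ) + 1 := by positivity
    have hm' : (0 : ℝ) < (m' : ℝ) + 1 := by positivity
    have hA : 0 ≤ (n.choose m : ℝ) := by positivity
    have hB : 0 ≤ (n.choose m' : ℝ) := by positivity
    have hmm : (m : ℝ) ≤ m' := by exact_mod_cast h
    -- (m+1)(m'+1) [C(n,m)C(n,m'+1)] = C(n,m) C(n,m') (n-m') (m+1)
    -- (m+1)(m'+1) [C(n,m+1)C(n,m')] = C(n,m) C(n,m') (n-m) (m'+1)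
    have key : ((m : ℝ) + 1) * ((m' : ℝ) + 1) * ((n.choose m : ℝ) * (n.choose (m' + 1) : ℝ)) ≤
        ((m : ℝ) + 1) * ((m' : ℝ) + 1) * ((n.choose (m + 1) : ℝ) * (n.choose m' : ℝ)) := by
      have e1 : ((m : ℝ) + 1) * ((m' : ℝ) + 1) * ((n.choose m : ℝ) * (n.choose (m' + 1) : ℝ)) =
          (n.choose m : ℝ) * (n.choose m' : ℝ) * (((n : ℝ) - m') * ((m : ℝ) + 1)) := by
        have : (n.choose (m' + 1) : ℝ) * ((m' : ℝ) + 1) = (n.choose m' : ℝ) * ((n : ℝ) - m') := c2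
        linear_combination ((m : ℝ) + 1) * (n.choose m : ℝ) * this
      have e2 : ((m : ℝ) + 1) * ((m' : ℝ) + 1) * ((n.choose (m + 1) : ℝ) * (n.choose m' : ℝ)) =
          (n.choose m : ℝ) * (n.choose m' : ℝ) * (((n : ℝ) - m) * ((m' : ℝ) + 1)) := by
        have : (n.choose (m + 1) : ℝ) * ((m : ℝ) + 1) = (n.choose m : ℝ) * ((n : ℝ) - m) := c1
        linear_combination ((m' : ℝ) + 1) * (n.choose m' : ℝ) * this
      rw [e1, e2]
      refine mul_le_mul_of_nonneg_left ?_ (mul_nonneg hA hB)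
      nlinarith
    have hpos : (0 : ℝ) < ((m : ℝ) + 1) * ((m' : ℝ) + 1) := mul_pos hm hm'
    exact le_of_mul_le_mul_left key hpos

/-- `Φ_0(t) = 2C(L,t)` is two-point log-concave. -/
theorem phi_lc2_zero (L m m' : ℕ) (h : m ≤ m') :
    ((L.choose m : ℝ) + (if 0 ≤ m then (L.choose (m - 0) : ℝ) else 0)) *
        ((L.choose (m' + 1) : ℝ) + (if 0 ≤ m' + 1 then (L.choose (m' + 1 - 0) : ℝ) else 0)) ≤
      ((L.choose (m + 1) : ℝ) + (if 0 ≤ m + 1 then (L.choose (m + 1 - 0) : ℝ) else 0)) *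
        ((L.choose m' : ℝ) + (if 0 ≤ m' then (L.choose (m' - 0) : ℝ) else 0)) := by
  simp only [zero_le, if_true, Nat.sub_zero]
  have h := choose_lc2 L m m' h
  nlinarith [h]

/-- Pascal: `Φ_1(t) = C(L,t) + C(L,t-1) = C(L+1,t)`. -/
theorem phi_one_eq (L t : ℕ) :
    (L.choose t : ℝ) + (if 1 ≤ t then (L.choose (t - 1) : ℝ) else 0) = ((L + 1).choose t : ℝ) := by
  rcases Nat.eq_zero_or_pos t with ht | ht
  · subst ht
    simp
  · rw [if_pos (show 1 ≤ t by omega)]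
    obtain ⟨s, rfl⟩ : ∃ s, t = s + 1 := ⟨t - 1, by omega⟩
    rw [Nat.choose_succ_succ' L s]
    have e : s + 1 - 1 = s := by omega
    rw [e]
    push_cast
    ring

/-- `Φ_1 = C(L+1,·)` is two-point log-concave. -/
theorem phi_lc2_one (L m m' : ℕ) (h : m ≤ m') :
    ((L.choose m : ℝ) + (if 1 ≤ m then (L.choose (m - 1) : ℝ) else 0)) *
        ((L.choose (m' + 1) : ℝ) + (if 1 ≤ m' + 1 then (L.choose (m' + 1 - 1) : ℝ) else 0)) ≤
      ((L.choose (m + 1) : ℝ) + (if 1 ≤ m + 1 then (L.choose (m + 1 - 1) : ℝ) else 0)) *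
        ((L.choose m' : ℝ) + (if 1 ≤ m' then (L.choose (m' - 1) : ℝ) else 0)) := by
  rw [phi_one_eq L m, phi_one_eq L (m' + 1), phi_one_eq L (m + 1), phi_one_eq L m']
  exact choose_lc2 (L + 1) m m' h

end TwoLevel

end Summit.CriticalPhenomena.PercolationContinuityZ3.Theorems
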